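import Summits.QuantumFields.YangMills.Theorems.UnitScaleTiltFluctuationComparisonRegPrGlobalSlackLegCfgDistT3
import HarnessLib

/-!
# `UnitScaleTiltFluctuationComparisonRegPrGlobalSlackLegCfgDistT3Window` — (44) FOR THE NATURAL OLD-LEVEL CONFIGURATION FAMILY AT A FREE WINDOW `ε₁` (hence at EVERY
# profile `p₁` of the door display `K1aLegRowsDisplayChiAt(Low)`), companion of `…LegCfgDistT3` (crux `FluctuationComparisonRegPrIntL`, stmt-QuantumFields-20520, skeletons
# v5kC / v5kD, STUB 3⁗χ; cell `pub/ym-inputs`, seat ym-inputs-p11; count-neutral helper, registry untouched)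

WHY.  `…LegCfgDistT3` §3/§5 read the window datum `V` at the record's profile, `PlaqSmall (θBal L γ b₀ p₀ n) V`.  The door display reads (R4-low) `CfgDistOwnΦLow D B dist 𝔠.b₀ p₁ C_s`
at a FREE profile `p₁ ≥ p₀ + r₀` (`…KernelLegDisplayProfileLow`), i.e. on the LARGER window `θ_{b₀,p₁}(n) ≥ θ_{b₀,p₀}(n)`; and r1 of `MinimiserRowsT3` is itself stated for an
arbitrary window `0 < ε₁ ≤ a₁` with `B₃ε₁ ≤ ε₀ ≤ a₀`.  So the natural statement is window-generic: for ANY `ε₁` in r1's range (and inside [B7] Prop. 2's letters), the (27)-loop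
variables of the `j`-fold `ℰp`-average of `U_{K−n}(triv, V↑)` obey (44) with `θ(n)` replaced by `ε₁`.  This file states exactly that (proofs = the landed ones with `ε₁` for `θ(n)`):
`plaqSmall_minimiser_of_rows_window`, `norm_B27T_avg_minimiser_le_window`, **`norm_B27T_avg_minimiser_le_canonLegDist_window`** (the right-hand side of
`CfgDistOwnΦLow … (canonLegDist F) b₀ p₁ (12·L·B₃)` at `ε₁ := θ_{b₀,p₁}(n)`, or any other window).  Def-free; nothing of [Balaban1985UV3] / [Balaban1985Variational] /
[Balaban1985Averaging] asserted beyond the cited tree theorems; no summit / rung / gap claim (YM₃ on T³ is ladder rung R3, not the Clay problem).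

References: T. Bałaban, CMP 102 (1985) 255–275 [Balaban1985UV3] ((27)–(28) p.263, (43)–(44) pp.266–267); CMP 102 (1985) 277–309 [Balaban1985Variational] ((2) p.278, Thm 1 (8)
p.279); CMP 98 (1985) 17–51 [Balaban1985Averaging] (Prop. 2 (52)–(54) p.26).
-/

set_option autoImplicit false

noncomputable section

open scoped Matrix.Norms.L2Operator
open Literature.MathematicalPhysics.QuantumFieldTheory.Balaban1983to89
open Literature.MathematicalPhysics.QuantumFieldTheory.Balaban1983to89.T3ContinuumYM3Torus
open Literature.MathematicalPhysics.QuantumFieldTheory.Balaban1983to89.T3UnitLawDensityEML (ℰp)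
open Literature.MathematicalPhysics.QuantumFieldTheory.Balaban1983to89.T3LevelShift (fieldShift)
open Literature.MathematicalPhysics.QuantumFieldTheory.Balaban1983to89.T3RegularMinimiser (regThreshold)
open Literature.MathematicalPhysics.QuantumFieldTheory.Balaban1983to89.T3PrintedRegularMinimiser (mem_regFibrePr_iff)
open Literature.MathematicalPhysics.QuantumFieldTheory.Balaban1983to89.B10Eq27TorusAxialLog
open Literature.MathematicalPhysics.QuantumFieldTheory.Balaban1983to89.B7Prop1Explicit (l1)
open Literature.MathematicalPhysics.QuantumFieldTheory.Balaban1983to89.ExpMeanLog (deltaSU)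
open Literature.MathematicalPhysics.QuantumFieldTheory.Balaban1985CMP102
open Literature.MathematicalPhysics.QuantumFieldTheory.Balaban1985CMP102.Setting
open Summit.QuantumFields.Balaban3D.Carriers
open Summit.QuantumFields.Balaban3D.Proofs.Primitives
open Summit.QuantumFields.YangMills.Theorems
open Summit.QuantumFields.YangMills.Theorems.GlobalSlackCanonicalPolymers

namespace Summit.QuantumFields.YangMills.Theorems.GlobalSlackKernelLeg

variable {F : T3Family} {𝔠 : AlphaConsts F.L (suGroupModel 2).N} {γ : ℝ} {hγ : 0 < γ} {hγ1 : γ ≤ (min 𝔠.gamma0 1) ^ 2} {a₀ a₁ : ℝ} {K : ℕ}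
  {UkH : (k : ℕ) → Hist (F.P K) k → GaugeField (F.P K) k (Matrix.specialUnitaryGroup (Fin 2) ℂ) →
    GaugeField (F.P K) 0 (Matrix.specialUnitaryGroup (Fin 2) ℂ)}

/-- **r1 AT A FREE WINDOW**: under `MinimiserRowsT3 … a₀ a₁ K UkH`, for `n < K`, ANY `0 < ε₁ ≤ a₁` with `B₃ε₁ ≤ a₀` and a datum `V` with `|V(∂p) − 1| < ε₁`, the minimiser
`U_{K−n}(triv, V↑)` has `|U(∂p) − 1| < B₃ε₁·L^{−2(K−n)}` for every plaquette of the finest lattice. [cite: Balaban1985Variational, Thm 1 (8) p.279, (2) p.278] -/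
theorem plaqSmall_minimiser_of_rows_window (hmin : MinimiserRowsT3 F 𝔠 γ hγ hγ1 a₀ a₁ K UkH) {n : ℕ} (hnK : n < K)
    {ε₁ : ℝ} (hε₁ : 0 < ε₁) (hε₁a₁ : ε₁ ≤ a₁) (hε₁a₀ : 𝔠.B₃ * ε₁ ≤ a₀)
    (V : GaugeField (F.P n) 0 (Matrix.specialUnitaryGroup (Fin 2) ℂ)) (hV : PlaqSmall ε₁ V) :
    PlaqSmall (regThreshold F n K (𝔠.B₃ * ε₁))
      (UkH (K - n) (Hist.triv (F.P K) (K - n))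
        (fieldShift (F.sitesPerDir_eq (m := F.m) (K := K) (j := K - n) (m' := F.m) (K' := n) (j' := 0) (by omega)) V)) :=
  ((mem_regFibrePr_iff F).mp (hmin.1 n hnK _ _ hε₁ hε₁a₁ le_rfl hε₁a₀ V hV).1).2.plaqSmall

/-- **(44) FOR THE NATURAL OLD-LEVEL CONFIGURATION FAMILY AT A FREE WINDOW**: as `norm_B27T_avg_minimiser_le` with `θ(n)` replaced by any window `ε₁` of r1's range inside
[B7] Prop. 2's letters: `‖B(c)‖ ≤ 4B₃·ε₁·|c₋ − y|₁·(L^{K−n−1−j})⁻²` for `j ≤ K − n` in print's regime `|c₋ − y|₁·2B₃ε₁(L^{K−n−j})⁻² ≤ ½`.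
[cite: Balaban1985UV3, (44) p.267; Balaban1985Variational, Thm 1 (8) p.279; Balaban1985Averaging, Prop. 2 (54) p.26] -/
theorem norm_B27T_avg_minimiser_le_window (hmin : MinimiserRowsT3 F 𝔠 γ hγ hγ1 a₀ a₁ K UkH) {n : ℕ} (hnK : n < K)
    {ε₁ : ℝ} (hε₁ : 0 < ε₁) (hε₁a₁ : ε₁ ≤ a₁) (hε₁a₀ : 𝔠.B₃ * ε₁ ≤ a₀)
    (he3 : (143 * ((((3 + 4 : ℕ) : ℝ)) ^ 2 / 4) ^ 2) * (𝔠.B₃ * ε₁) ≤ 1 / 3)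
    (he2 : 2 * (𝔠.B₃ * ε₁) ≤ 2 * deltaSU (Fin 2) / (((3 + 4) * F.L : ℕ) : ℝ) ^ 2)
    (V : GaugeField (F.P n) 0 (Matrix.specialUnitaryGroup (Fin 2) ℂ)) (hV : PlaqSmall ε₁ V)
    {j : ℕ} (hj : j ≤ K - n) (y : Site (F.P K) j) (c : PBond (F.P K) j)
    (hsmall : (l1 (rel y c.src) : ℝ) * (2 * (𝔠.B₃ * ε₁) * (((F.L : ℝ) ^ (K - n - j))⁻¹) ^ 2) ≤ 1 / 2) :
    ‖B27T (unitsField (toUField (Averaging.iter (fun i => BlockAveraging.blockAvg (P := F.P K) (j := i) ℰp) j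
        (UkH (K - n) (Hist.triv (F.P K) (K - n))
          (fieldShift (F.sitesPerDir_eq (m := F.m) (K := K) (j := K - n) (m' := F.m) (K' := n) (j' := 0) (by omega)) V))))) y c‖ ≤
      4 * 𝔠.B₃ * ε₁ * (l1 (rel y c.src) : ℝ) * (((F.L : ℝ) ^ (K - n - 1 - j))⁻¹) ^ 2 := by
  have h := norm_B27T_iter_blockAvg_le_T3_row F (mul_pos 𝔠.B₃_pos hε₁) he3 he2
    (plaqSmall_minimiser_of_rows_window hmin hnK hε₁ hε₁a₁ hε₁a₀ V hV) hj y c hsmall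
  calc _ ≤ _ := h
    _ = _ := by ring

/-- **(44) AT A FREE WINDOW, IN THE CURRENCY OF `CfgDistOwnΦLow`**: for an old level `j + 1 < K − n`, `Y = blockSet K (j+1) y′`, any anchor `y ∈ anchors K j Y`, any window `ε₁`
of r1's range inside [B7] Prop. 2's letters, in print's regime: `‖B(c)‖ ≤ (12·L·B₃)·(1 + canonLegDist F K j Y c)·ε₁·(L^{K−n−1−j})⁻²` — at `ε₁ := θ_{b₀,p₁}(n)` this is the
right-hand side of `CfgDistOwnΦLow … (canonLegDist F) b₀ p₁ (12·L·B₃)` for EVERY profile `p₁` (the door's `p₁ ≥ p₀ + r₀` included).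
[cite: Balaban1985UV3, (44) p.267, (27)-(28) p.263; Balaban1985Variational, Thm 1 (8) p.279; Balaban1985Averaging, Prop. 2 (54) p.26] -/
theorem norm_B27T_avg_minimiser_le_canonLegDist_window (hmin : MinimiserRowsT3 F 𝔠 γ hγ hγ1 a₀ a₁ K UkH) {n : ℕ} (hnK : n < K)
    {ε₁ : ℝ} (hε₁ : 0 < ε₁) (hε₁a₁ : ε₁ ≤ a₁) (hε₁a₀ : 𝔠.B₃ * ε₁ ≤ a₀)
    (he3 : (143 * ((((3 + 4 : ℕ) : ℝ)) ^ 2 / 4) ^ 2) * (𝔠.B₃ * ε₁) ≤ 1 / 3)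
    (he2 : 2 * (𝔠.B₃ * ε₁) ≤ 2 * deltaSU (Fin 2) / (((3 + 4) * F.L : ℕ) : ℝ) ^ 2)
    (V : GaugeField (F.P n) 0 (Matrix.specialUnitaryGroup (Fin 2) ℂ)) (hV : PlaqSmall ε₁ V)
    {j i : ℕ} (hij : i = j + 1) (hi : i < K - n) (y' : Site (F.P K) i) {y : Site (F.P K) j} (hy : y ∈ anchors K j (blockSet K i y'))
    (c : PBond (F.P K) j)
    (hsmall : (l1 (rel y c.src) : ℝ) * (2 * (𝔠.B₃ * ε₁) * (((F.L : ℝ) ^ (K - n - j))⁻¹) ^ 2) ≤ 1 / 2) :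
    ‖B27T (unitsField (toUField (Averaging.iter (fun i => BlockAveraging.blockAvg (P := F.P K) (j := i) ℰp) j
        (UkH (K - n) (Hist.triv (F.P K) (K - n))
          (fieldShift (F.sitesPerDir_eq (m := F.m) (K := K) (j := K - n) (m' := F.m) (K' := n) (j' := 0) (by omega)) V))))) y c‖ ≤
      (12 * (F.L : ℝ) * 𝔠.B₃) * (1 + canonLegDist F K j (blockSet K i y') c) * ε₁ * (((F.L : ℝ) ^ (K - n - 1 - j))⁻¹) ^ 2 := by
  have hB : 0 < 𝔠.B₃ := 𝔠.B₃_pos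
  have h1 := norm_B27T_avg_minimiser_le_window hmin hnK hε₁ hε₁a₁ hε₁a₀ he3 he2 V hV (show j ≤ K - n by omega) y c hsmall
  have h2 := l1_rel_le_mul_one_add_canonLegDist hij (show i ≤ F.m + K by omega) y' hy c
  have hx : 0 ≤ (((F.L : ℝ) ^ (K - n - 1 - j))⁻¹) ^ 2 := by positivity
  have h3 : 4 * 𝔠.B₃ * ε₁ * (l1 (rel y c.src) : ℝ) ≤ 4 * 𝔠.B₃ * ε₁ * (3 * (F.L : ℝ) * (1 + canonLegDist F K j (blockSet K i y') c)) :=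
    mul_le_mul_of_nonneg_left h2 (by positivity)
  calc _ ≤ 4 * 𝔠.B₃ * ε₁ * (l1 (rel y c.src) : ℝ) * (((F.L : ℝ) ^ (K - n - 1 - j))⁻¹) ^ 2 := h1
    _ ≤ 4 * 𝔠.B₃ * ε₁ * (3 * (F.L : ℝ) * (1 + canonLegDist F K j (blockSet K i y') c)) * (((F.L : ℝ) ^ (K - n - 1 - j))⁻¹) ^ 2 :=
        mul_le_mul_of_nonneg_right h3 hx
    _ = _ := by ring

end Summit.QuantumFields.YangMills.Theorems.GlobalSlackKernelLeg

end
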